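import Literature.MathematicalPhysics.QuantumFieldTheory.BalabanImbrieJaffe1984to88.BIJ88Clusters5134

/-!
# `BalabanImbrieJaffe1984to88.BIJ88PolymerRep5134` — T. Bałaban, J. Imbrie, A. Jaffe, *Effective action and cluster properties of the abelian
Higgs model*, Commun. Math. Phys. **114** (1988) 257–315 [BalabanImbrieJaffe1988], §5.13 p. 306 [PDF 50]: **display (5.13.4), its left-hand
equality — the POLYMER REPRESENTATION** *"Σ_{S_Y}Σ_{S_5} e^{−V^{(k)}_{const}(Λ^{(k)}_8)} Σ_{{X_α} filling Λ^{(k)}_{10}} Π_α g₁(X_α) = …"* of the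
expectation `⟨Π_{i∈I} f(□_i)⟩_1` (p. 304) at fixed Mayer data — DERIVED (from the p. 305 FTC expansion in corner form and the p. 306 cluster
factorization, `BIJ88Clusters5134`) for every cluster-factorizing family of corner expectations, WITH THE PRINTED ACTIVITIES `g₁` (p. 306:
*"Given some region X, a union of □_i, we sum Γ over all subsets of {i ∈ I: □_i ⊂ X}, such that X is a single cluster"*), together with a
KERNEL-CHECKED READING NOTE: the fillings `{X_α}` are the CLUSTER CONFIGURATIONS — with the paper's cube-wise interpolation two abutting
polymers of ≥ 2 cubes never arise from one `Γ` (they would be one component), and summed over ALL set partitions into polymers the right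
side of (5.13.4) over-counts (`sum_setPartitions_eq`, witness `sum_setPartitions_ne_W4`).

statement-level skeleton of published theorems with citation tags; proofs where landed; nothing here is a claim about the Yang–Mills mass gap

PDF held: `paper:balaban1988-cmp114-bij-abelian-higgs-effective-action` (journal page = PDF page + 256); p. 306 = PDF 50 rendered and read as an
image this session (`renders/original-p050-x2.png` of the p25 seat).

**The print (verbatim, p. 306).** *"Call the factorization regions clusters. … We give now the expression for the polymer activities of this
expansion. Given some region X, a union of □_i, we sum Γ over all subsets of {i ∈ I : □_i ⊂ X}, such that X is a single cluster. Writing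
C_ω = C_s□_{i_1}Δ□_{i_2}C_s□_{i_3}…□_{i_{|ω|}}C_s, we have g₁(X) = Σ_Γ ∫ds_Γ Σ_{π∈𝒫(Γ)} ⟨Π_{α∈π}[Σ_{ω(α)}⟨δ/δΦ, C_{ω(α)}(½ δ/δΦ + ℱ)⟩] Π_{□_i⊂X}
f(□_i)⟩_{s_Γ,X}. Here s = {s_i : □_i ⊂ X}, and ⟨·⟩_{s_Γ,X} is defined by integrating over the fields in X only. We obtain the following expressions
for the dμ^{(k)}_{Λ^{(k)}_{10}}-integral in (5.12.8): Σ_{S_Y}Σ_{S_5} e^{−V^{(k)}_{const}(Λ^{(k)}_8)} Σ_{{X_α} filling Λ^{(k)}_{10}} Π_α g₁(X_α) =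
e^{−V^{(k)}_{const}(Λ^{(k)}_8)} Σ_{{X_α}} Π_α g₂(X_α). (5.13.4)"*

**What is proved (0 `sorry`, standard axioms, 0 new `Prop` facts).** Setting of `BIJ88Clusters5134`: cubes `ι`, abutting `adj`, corner
expectations `z X Λ = ⟨Π_{i∈X}f(□_i)⟩_{1_Λ,X}` with `hz : IsClusterFactorizing adj z`; fillings of a region `W` = its set partitions
(`Literature.Probability.LatticeModels.setPartitions`, as in `BIJ88Resummation5141`).
* §5 `IsConn adj X` (*"X is a single cluster"* with all its cubes active); **`g1 adj z X := Σ_{Γ⊆X, clusters(X,Γ)={X}} cornerSum (z X) Γ`** — the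
  printed `g₁(X)` with its `Γ`-term `∫ds_Γ∂_Γ⟨Π_{□_i⊂X}f(□_i)⟩_{s_Γ,X}` in corner form (the walk evaluation of the derivative is (5.13.3), not
  reproduced); `g1_singleton` (`g₁({i}) = z{i}{i}`), **`g1_of_two_le`** (`g₁(X) = [X connected]·cornerSum (z X) X` for `|X| ≥ 2`);
  `IsAdmissible adj P` (no two distinct polymers of ≥ 2 cubes contain an abutting pair); `isConn_of_mem_clusters`, `isAdmissible_clusters`,
  `noIso_bigPart`, `bigPart_clusters`, **`clusters_bigPart`** (the bijection `Γ ↦ clusters(W,Γ)` between the `Γ ⊆ W` without isolated point and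
  the admissible fillings by connected polymers, inverse = union of the non-singleton polymers); **`polymerRep`** —
  DISPLAY (5.13.4) LEFT EQUALITY: `z W W = Σ_{P ∈ setPartitions W, admissible} Π_{X∈P} g1 adj z X`; **`sum_setPartitions_eq`**:
  `Σ_{ALL P ∈ setPartitions W} Π g1 = z W W + Σ_{P not admissible} Π g1`.
* §6 `zOf adj c X Λ := Π_{K∈clusters(X,Λ)} c K` — a supply of corner data: **`isClusterFactorizing_zOf`** (every weight `c`); `act_zOf`,
  `g1_zOf_of_two_le`, `g1_zOf_singleton`, `g1_empty`.
* §7 THE WITNESS (`ι = ℤ`, `adj = nn` nearest neighbours, `W4 = {0,1,2,3}`, weight `cPath` = `0` on single cubes, `1` otherwise; `decide` +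
  the general lemmas): `witness_filling` (`{{0,1},{2,3}}` is a filling, NOT admissible, with `Π g₁ = 1`), `two_le_sum_setPartitions_W4`,
  **`sum_setPartitions_ne_W4`**: `Σ_{all fillings} Π g₁ ≠ z W W` (`≥ 2` vs. `1`) while the admissible sum equals `z W W`.

**Reading note (GAPS.md G-C2-p25-03).** The paper does not define *"filling"*; with its CUBE-wise parameters `s_i` (p. 304: *"parameters
s_i ∈ [0,1], i ∈ I, which turn off interactions between □_i and □_j"*, p. 305 `□_iΔ_s□_{i′} = s_is_{i′}□_iΔ□_{i′}`) the clusters of `Γ` are the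
components of the INDUCED abutting graph on `Γ` plus the inactive singletons, so a cluster configuration never contains two abutting non-singleton
polymers; (5.13.4) holds with `{X_α}` ranging over cluster configurations (= `IsAdmissible` set partitions — proved here), and fails if `{X_α}` ranges
over all set partitions into polymers (the GJS bond-wise interpolation [9], *"very similar"*, has no such proviso). The displayed hypothesis `hdec`
of this seat's `BIJ88Resummation5141.zF_eq_sum_fillings` (all set partitions) is therefore to be fed with the admissible restriction; see GAPS.md.
NOT summit progress; NOT continuum; NOT Clay. Imports: `BIJ88Clusters5134` only; modifies nothing. Cell `lit-balaban` Phase 2, seat p25 gen 8;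
row C2.Eq5.13.3-5.13.4 (owner r16, referee ref-5).
-/

open Finset
open Literature.Probability.LatticeModels (IsSetPartition setPartitions mem_setPartitions)
open Literature.MathematicalPhysics.QuantumFieldTheory.BalabanImbrieJaffe1984to88.BIJ88Clusters5134

namespace Literature.MathematicalPhysics.QuantumFieldTheory.BalabanImbrieJaffe1984to88.BIJ88PolymerRep5134

variable {ι : Type*} [DecidableEq ι]

/-! ## §5 *"such that X is a single cluster"*: connected regions, the printed activities `g₁`, admissible fillings, and THE REGROUPING -/

section CornerPoint

/-- the parameter corner `s = 1_Λ` (p. 305: *"s_Γ specifies s_i = 0 for i ∉ Γ"*; `⟨·⟩_1` is `s ≡ 1`): `s_i = 1` for `i ∈ Λ`, `0` otherwise —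
the points at which the corner expectations `z X Λ = ⟨Π_{□_i⊂X} f(□_i)⟩_{1_Λ,X}` are taken (used by the companion files for the Gaussian
instance and for the derivative form of `g₁`). [cite: BalabanImbrieJaffe1988, (5.13.3) p.305] -/
def corner (R : Type*) [Zero R] [One R] (Λ : Finset ι) : ι → R := fun i => if i ∈ Λ then 1 else 0

/-- the corner `1_Λ` at a cube. [cite: BalabanImbrieJaffe1988, (5.13.3) p.305] -/
theorem corner_apply (R : Type*) [Zero R] [One R] (Λ : Finset ι) (i : ι) : corner R Λ i = if i ∈ Λ then 1 else 0 := rfl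

end CornerPoint

section Fillings

variable (adj : ι → ι → Prop) [DecidableRel adj] {R : Type*} [CommRing R]

/-- p. 306: *"Given some region X, a union of □_i, we sum Γ over all subsets of {i ∈ I : □_i ⊂ X}, such that X is a single cluster"* — `X`
is a single cluster of itself when all its cubes are active: `X` is CONNECTED under abutting. [cite: BalabanImbrieJaffe1988, p.306 (Sect. 5.13)] -/
def IsConn (X : Finset ι) : Prop := ∀ i ∈ X, cluster adj X X i = X

/-- decidability of connectedness. [cite: BalabanImbrieJaffe1988, p.306 (Sect. 5.13)] -/
instance instDecidableIsConn (X : Finset ι) : Decidable (IsConn adj X) :=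
  inferInstanceAs (Decidable (∀ i ∈ X, cluster adj X X i = X))

/-- **the polymer activity `g₁(X)`** of p. 306 [PDF 50], verbatim: *"Given some region X, a union of □_i, we sum Γ over all subsets of
{i ∈ I : □_i ⊂ X}, such that X is a single cluster. … g₁(X) = Σ_Γ ∫ds_Γ Σ_{π∈𝒫(Γ)} ⟨Π_{α∈π}[Σ_{ω(α)} ⟨δ/δΦ, C_{ω(α)}(½δ/δΦ + ℱ)⟩]
Π_{□_i⊂X} f(□_i)⟩_{s_Γ,X}. Here s = {s_i : □_i ⊂ X}, and ⟨·⟩_{s_Γ,X} is defined by integrating over the fields in X only"* — with the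
`Γ`-term `∫ds_Γ ∂_Γ⟨Π_{□_i⊂X} f(□_i)⟩_{s_Γ,X}` in corner form (`cornerSum (z X) Γ`; its evaluation as the displayed sum over partitions
`π` and walks `ω` is (5.13.3), not reproduced here), summed over the `Γ ⊆ X` for which `X` is a single cluster.
[cite: BalabanImbrieJaffe1988, p.306 (Sect. 5.13)] -/
def g1 (z : Finset ι → Finset ι → R) (X : Finset ι) : R :=
  ∑ Γ ∈ X.powerset with clusters adj X Γ = {X}, cornerSum (z X) Γ

/-- `X ≠ ∅` is a single cluster of `Γ` iff every cube of `X` has cluster `X`. [cite: BalabanImbrieJaffe1988, p.306 (Sect. 5.13)] -/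
theorem clusters_eq_singleton_iff {X Γ : Finset ι} (hX : X.Nonempty) :
    clusters adj X Γ = {X} ↔ ∀ i ∈ X, cluster adj X Γ i = X := by
  constructor
  · intro h i hi
    have hmem := cluster_mem_clusters adj (Λ := Γ) hi
    rw [h, mem_singleton] at hmem
    exact hmem
  · intro h
    refine Subset.antisymm (fun K hK => ?_) (singleton_subset_iff.2 ?_)
    · obtain ⟨i, hi, rfl⟩ := (mem_clusters adj).1 hK
      exact mem_singleton.2 (h i hi)
    · obtain ⟨i, hi⟩ := hX
      have hm := cluster_mem_clusters adj (Λ := Γ) hi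
      rwa [h i hi] at hm

/-- a one-cube region is a single cluster whatever the active set. [cite: BalabanImbrieJaffe1988, p.306 (Sect. 5.13)] -/
theorem cluster_singleton_region (Γ : Finset ι) (i : ι) : cluster adj {i} Γ i = {i} := by
  have hsub : cluster adj {i} Γ i ⊆ {i} := cluster_subset adj {i} Γ i
  have hmem : i ∈ cluster adj {i} Γ i := mem_cluster_self adj (mem_singleton_self i)
  exact Subset.antisymm hsub (singleton_subset_iff.2 hmem)

/-- a one-cube region is a single cluster whatever the active set. [cite: BalabanImbrieJaffe1988, p.306 (Sect. 5.13)] -/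
theorem clusters_singleton_region (Γ : Finset ι) (i : ι) : clusters adj {i} Γ = {{i}} :=
  (clusters_eq_singleton_iff adj (singleton_nonempty i)).2 fun j hj => by
    rw [mem_singleton.1 hj]
    exact cluster_singleton_region adj Γ i

/-- a one-cube region is connected. [cite: BalabanImbrieJaffe1988, p.306 (Sect. 5.13)] -/
theorem isConn_singleton (i : ι) : IsConn adj {i} := fun j hj => by
  rw [mem_singleton.1 hj]
  exact cluster_singleton_region adj {i} i

/-- **`g₁` of a single cube is its bare expectation**: `g₁({i}) = z {i} {i}` (`= ⟨f(□_i)⟩`, the terms `Γ = ∅` and `Γ = {i}` of the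
printed sum, the latter being `z {i} {i} − z {i} ∅`). [cite: BalabanImbrieJaffe1988, p.306 (Sect. 5.13)] -/
theorem g1_singleton (z : Finset ι → Finset ι → R) (i : ι) : g1 adj z {i} = z {i} {i} := by
  rw [g1, filter_true_of_mem fun Γ _ => clusters_singleton_region adj Γ i]
  have hp : ({i} : Finset ι).powerset = {∅, {i}} := by
    ext S
    simp only [mem_powerset, subset_singleton_iff, mem_insert, mem_singleton]
  rw [hp, sum_insert (by simp), sum_singleton, cornerSum_empty, cornerSum_singleton]
  ring

/-- for a region of at least two cubes, `X` is a single cluster of `Γ ⊆ X` iff `Γ = X` (every cube interpolated) and `X` is connected.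
[cite: BalabanImbrieJaffe1988, p.306 (Sect. 5.13)] -/
theorem clusters_eq_singleton_iff_of_two_le {X Γ : Finset ι} (h2 : 2 ≤ X.card) (hΓ : Γ ⊆ X) :
    clusters adj X Γ = {X} ↔ Γ = X ∧ IsConn adj X := by
  have hX : X.Nonempty := card_pos.1 (by omega)
  rw [clusters_eq_singleton_iff adj hX]
  constructor
  · intro h
    have hXΓ : X ⊆ Γ := by
      intro i hi
      by_contra hiΓ
      have h1 := h i hi
      rw [cluster_of_not_mem adj hi hiΓ] at h1
      rw [← h1, card_singleton] at h2
      omega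
    have he : Γ = X := Subset.antisymm hΓ hXΓ
    subst he
    exact ⟨rfl, h⟩
  · rintro ⟨rfl, h⟩
    exact h

/-- **`g₁` of a larger region is its derivative activity if the region is connected, and `0` otherwise**:
`g₁(X) = [X connected]·Σ_{Λ⊆X}(−1)^{|X∖Λ|} z X Λ` (`= ∫ds_X ∂_X⟨Π_{□_i⊂X}f(□_i)⟩_{s,X}`) for `|X| ≥ 2`. [cite: BalabanImbrieJaffe1988, p.306 (Sect. 5.13)] -/
theorem g1_of_two_le (z : Finset ι → Finset ι → R) {X : Finset ι} (h2 : 2 ≤ X.card) :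
    g1 adj z X = if IsConn adj X then act z X else 0 := by
  have hf : X.powerset.filter (fun Γ => clusters adj X Γ = {X}) = if IsConn adj X then {X} else ∅ := by
    ext Γ
    simp only [mem_filter, mem_powerset]
    constructor
    · rintro ⟨hΓ, hcl⟩
      obtain ⟨rfl, hc⟩ := (clusters_eq_singleton_iff_of_two_le adj h2 hΓ).1 hcl
      simp [hc]
    · intro h
      split_ifs at h with hc
      · rw [mem_singleton] at h
        subst h
        exact ⟨Subset.rfl, (clusters_eq_singleton_iff_of_two_le adj h2 Subset.rfl).2 ⟨rfl, hc⟩⟩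
      · exact absurd h (notMem_empty Γ)
  rw [g1, hf]
  split_ifs
  · rw [sum_singleton, act]
  · rw [sum_empty]

/-- **ADMISSIBLE fillings** — the fillings `{X_α}` that ARISE as cluster configurations of some `Γ`: no two distinct polymers of at
least two cubes each contain abutting cubes (two adjacent interpolated components would be ONE component). With cube-wise decoupling
parameters (p. 304: *"we interpolate the covariance with parameters s_i ∈ [0,1], i ∈ I, which turn off interactions between □_i and □_j"*;
p. 305: `□_iΔ_s□_{i′} = s_is_{i′}□_iΔ□_{i′}`) this proviso is part of the meaning of *"{X_α} filling Λ^{(k)}_{10}"* in (5.13.4); summed over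
ALL set partitions the right side of (5.13.4) over-counts (`sum_setPartitions_eq`, and the witness of §6). [cite: BalabanImbrieJaffe1988, (5.13.4) p.306] -/
def IsAdmissible (P : Finset (Finset ι)) : Prop :=
  ∀ X ∈ P, ∀ X' ∈ P, X ≠ X' → 2 ≤ X.card → 2 ≤ X'.card → ∀ j ∈ X, ∀ j' ∈ X', ¬ adj j j'

/-- decidability of admissibility. [cite: BalabanImbrieJaffe1988, (5.13.4) p.306] -/
instance instDecidableIsAdmissible (P : Finset (Finset ι)) : Decidable (IsAdmissible adj P) :=
  inferInstanceAs (Decidable (∀ X ∈ P, ∀ X' ∈ P, X ≠ X' → 2 ≤ X.card → 2 ≤ X'.card → ∀ j ∈ X, ∀ j' ∈ X', ¬ adj j j'))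

/-- `Γ` has no isolated interpolated cube (every component of `Γ` has at least two cubes). [cite: BalabanImbrieJaffe1988, p.306 (Sect. 5.13)] -/
def NoIso (W Γ : Finset ι) : Prop := ∀ i ∈ Γ, cluster adj W Γ i ≠ {i}

/-- decidability. [cite: BalabanImbrieJaffe1988, p.306 (Sect. 5.13)] -/
instance instDecidableNoIso (W Γ : Finset ι) : Decidable (NoIso adj W Γ) :=
  inferInstanceAs (Decidable (∀ i ∈ Γ, cluster adj W Γ i ≠ {i}))

/-- the interpolated cubes of a filling: the union of its polymers of at least two cubes. [cite: BalabanImbrieJaffe1988, p.306 (Sect. 5.13)] -/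
def bigPart (P : Finset (Finset ι)) : Finset ι := (P.filter fun X => 2 ≤ X.card).biUnion id

variable {adj}

/-- the cluster of a cube in a larger region with more active cubes is larger. [cite: BalabanImbrieJaffe1988, p.306 (Sect. 5.13)] -/
theorem cluster_mono {X W Γ : Finset ι} (hXW : X ⊆ W) (hXΓ : X ⊆ Γ) {i : ι} (hi : i ∈ X) :
    cluster adj X X i ⊆ cluster adj W Γ i := by
  have h : cluster adj X X i ⊆ cluster adj W Γ i ∩ X := by
    refine cluster_subset_of_closed adj inter_subset_right (mem_inter.2 ⟨mem_cluster_self adj (hXW hi), hi⟩) ?_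
    intro j hj j' hj'X hjX _ hne hadj
    exact mem_inter.2 ⟨mem_cluster_of_adj adj (mem_inter.1 hj).1 (hXΓ hjX) (hXΓ hj'X) (hXW hj'X) hne hadj, hj'X⟩
  exact h.trans inter_subset_left

/-- **clusters are connected** (*"X is a single cluster"* holds for every cluster with all its cubes interpolated).
[cite: BalabanImbrieJaffe1988, p.306 (Sect. 5.13)] -/
theorem isConn_of_mem_clusters {W Γ K : Finset ι} (hK : K ∈ clusters adj W Γ) : IsConn adj K := by
  obtain ⟨i₀, hi₀, rfl⟩ := (mem_clusters adj).1 hK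
  intro i hi
  have hKi : cluster adj W Γ i = cluster adj W Γ i₀ := cluster_eq_of_mem adj hi₀ hi
  set K := cluster adj W Γ i₀ with hKdef
  have hKW : K ⊆ W := cluster_subset adj W Γ i₀
  refine Subset.antisymm (cluster_subset adj K K i) ?_
  set T := cluster adj K K i
  have hTK : T ⊆ K := cluster_subset adj K K i
  -- `T ∪ (W ∖ K)` is closed in `W` for the active set `Γ` and contains `i`, hence contains `cluster W Γ i = K`
  have hcl : cluster adj W Γ i ⊆ T ∪ (W \ K) := by
    refine cluster_subset_of_closed adj (union_subset (hTK.trans hKW) sdiff_subset)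
      (mem_union_left _ (mem_cluster_self adj hi)) ?_
    intro j hj j' hj'W hjΓ hj'Γ hne hadj
    rcases mem_union.1 hj with hjT | hjWK
    · have hjK : j ∈ K := hTK hjT
      have hj'K : j' ∈ K := by
        have h := mem_cluster_of_adj adj (hKi ▸ hjK : j ∈ cluster adj W Γ i) hjΓ hj'Γ hj'W hne hadj
        rwa [hKi] at h
      exact mem_union_left _ (mem_cluster_of_adj adj hjT hjK hj'K hj'K hne hadj)
    · by_cases hj'K : j' ∈ K
      · exfalso
        have h := mem_cluster_of_adj adj (hKi ▸ hj'K : j' ∈ cluster adj W Γ i) hj'Γ hjΓ (mem_sdiff.1 hjWK).1 hne.symm hadj.symm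
        rw [hKi] at h
        exact (mem_sdiff.1 hjWK).2 h
      · exact mem_union_right _ (mem_sdiff.2 ⟨hj'W, hj'K⟩)
  intro x hxK
  have hx : x ∈ T ∪ (W \ K) := hcl (hKi.symm ▸ hxK)
  rcases mem_union.1 hx with hxT | hxWK
  · exact hxT
  · exact absurd hxK (mem_sdiff.1 hxWK).2

omit [DecidableEq ι] in
/-- a set with a member other than `i` has at least two elements. [cite: BalabanImbrieJaffe1988, p.306 (Sect. 5.13)] -/
theorem two_le_card_of_ne_singleton {K : Finset ι} {i : ι} (hi : i ∈ K) (hne : K ≠ {i}) : 2 ≤ K.card := by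
  rcases eq_singleton_or_nontrivial hi with h | h
  · exact absurd h hne
  · exact one_lt_card_iff_nontrivial.2 h

/-- (a) **cluster configurations are admissible**: two different clusters of at least two cubes contain no abutting pair.
[cite: BalabanImbrieJaffe1988, p.306 (Sect. 5.13)] -/
theorem isAdmissible_clusters (W Γ : Finset ι) : IsAdmissible adj (clusters adj W Γ) := by
  intro X hX X' hX' hne h2 h2' j hj j' hj'
  have hXΓ : X ⊆ Γ := subset_active_of_two_le adj hX h2
  have hX'Γ : X' ⊆ Γ := subset_active_of_two_le adj hX' h2'
  obtain ⟨i, hi, rfl⟩ := (mem_clusters adj).1 hX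
  obtain ⟨i', hi', rfl⟩ := (mem_clusters adj).1 hX'
  refine not_adj_of_cluster_ne adj (cluster_subset adj W Γ i hj) (cluster_subset adj W Γ i' hj') (hXΓ hj) (hX'Γ hj') ?_
  rwa [cluster_eq_of_mem adj hi hj, cluster_eq_of_mem adj hi' hj']

/-- (b) the interpolated set of an admissible filling by connected polymers has no isolated cube. [cite: BalabanImbrieJaffe1988, p.306 (Sect. 5.13)] -/
theorem noIso_bigPart {W : Finset ι} {P : Finset (Finset ι)} (hP : IsSetPartition W P) (hconn : ∀ X ∈ P, IsConn adj X) :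
    NoIso adj W (bigPart P) := by
  intro i hi hiso
  simp only [bigPart, mem_biUnion, mem_filter, id] at hi
  obtain ⟨X, ⟨hXP, h2⟩, hiX⟩ := hi
  have hXΓ : X ⊆ bigPart P := by
    intro x hx
    simp only [bigPart, mem_biUnion, mem_filter, id]
    exact ⟨X, ⟨hXP, h2⟩, hx⟩
  have hsub : cluster adj X X i ⊆ cluster adj W (bigPart P) i := cluster_mono (hP.subset hXP) hXΓ hiX
  rw [hconn X hXP i hiX, hiso] at hsub
  have := card_le_card hsub
  rw [card_singleton] at this
  omega

/-- (c) the interpolated set is recovered from the cluster configuration. [cite: BalabanImbrieJaffe1988, p.306 (Sect. 5.13)] -/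
theorem bigPart_clusters {W Γ : Finset ι} (hΓ : Γ ⊆ W) (hno : NoIso adj W Γ) : bigPart (clusters adj W Γ) = Γ := by
  ext i
  simp only [bigPart, mem_biUnion, mem_filter, id]
  constructor
  · rintro ⟨K, ⟨hK, h2⟩, hiK⟩
    exact subset_active_of_two_le adj hK h2 hiK
  · intro hi
    exact ⟨cluster adj W Γ i, ⟨cluster_mem_clusters adj (hΓ hi), two_le_card_of_ne_singleton (mem_cluster_self adj (hΓ hi)) (hno i hi)⟩,
      mem_cluster_self adj (hΓ hi)⟩

/-- (d) **an admissible filling by connected polymers IS the cluster configuration of its interpolated set**.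
[cite: BalabanImbrieJaffe1988, p.306 (Sect. 5.13)] -/
theorem clusters_bigPart {W : Finset ι} {P : Finset (Finset ι)} (hP : IsSetPartition W P) (hadm : IsAdmissible adj P)
    (hconn : ∀ X ∈ P, IsConn adj X) : clusters adj W (bigPart P) = P := by
  have key : ∀ X ∈ P, ∀ i ∈ X, cluster adj W (bigPart P) i = X := by
    intro X hXP i hiX
    have hXW : X ⊆ W := hP.subset hXP
    by_cases h2 : 2 ≤ X.card
    · have hXΓ : X ⊆ bigPart P := by
        intro x hx
        simp only [bigPart, mem_biUnion, mem_filter, id]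
        exact ⟨X, ⟨hXP, h2⟩, hx⟩
      have hsup : cluster adj X X i ⊆ cluster adj W (bigPart P) i := cluster_mono hXW hXΓ hiX
      rw [hconn X hXP i hiX] at hsup
      refine Subset.antisymm ?_ hsup
      refine cluster_subset_of_closed adj hXW hiX ?_
      intro j hj j' _ _ hj'Γ hne hadj
      simp only [bigPart, mem_biUnion, mem_filter, id] at hj'Γ
      obtain ⟨X', ⟨hX'P, h2'⟩, hj'X'⟩ := hj'Γ
      by_cases hXX' : X = X'
      · exact hXX' ▸ hj'X'
      · exfalso
        rcases hadj with h | h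
        · exact hadm X hXP X' hX'P hXX' h2 h2' j hj j' hj'X' h
        · exact hadm X' hX'P X hXP (Ne.symm hXX') h2' h2 j' hj'X' j hj h
    · have hcard : X.card = 1 := by
        have := (hP.nonempty_of_mem hXP).card_pos
        omega
      obtain ⟨i₀, rfl⟩ := card_eq_one.1 hcard
      have hi : i = i₀ := mem_singleton.1 hiX
      subst hi
      refine cluster_of_not_mem adj (hXW hiX) fun hiΓ => ?_
      simp only [bigPart, mem_biUnion, mem_filter, id] at hiΓ
      obtain ⟨X', ⟨hX'P, h2'⟩, hiX'⟩ := hiΓ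
      have := hP.eq_of_mem hXP hX'P hiX hiX'
      rw [← this, card_singleton] at h2'
      omega
  ext K
  rw [mem_clusters]
  constructor
  · rintro ⟨i, hi, rfl⟩
    obtain ⟨X, hXP, hiX⟩ := hP.exists_mem hi
    rw [key X hXP i hiX]
    exact hXP
  · intro hK
    obtain ⟨i, hi⟩ := hP.nonempty_of_mem hK
    exact ⟨i, hP.subset hK hi, key K hK i hi⟩

/-- (e) the `Γ`-term of the factorized expansion is the product of the printed activities over the cluster configuration of `Γ`
(for cluster-factorizing data: the inactive cubes carry `g₁({i}) = z{i}{i} = z{i}∅`). [cite: BalabanImbrieJaffe1988, (5.13.4) p.306] -/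
theorem term_eq_prod_g1 {z : Finset ι → Finset ι → R} (hz : IsClusterFactorizing adj z) {W Γ : Finset ι}
    (hno : NoIso adj W Γ) :
    (∏ K ∈ (clusters adj W Γ).filter (· ⊆ Γ), act z K) * ∏ i ∈ W \ Γ, z {i} ∅ = ∏ X ∈ clusters adj W Γ, g1 adj z X := by
  rw [← prod_filter_mul_prod_filter_not (clusters adj W Γ) (· ⊆ Γ)]
  congr 1
  · refine prod_congr rfl fun K hK => ?_
    obtain ⟨hK, hKΓ⟩ := mem_filter.1 hK
    obtain ⟨i₀, hi₀, rfl⟩ := (mem_clusters adj).1 hK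
    have hi₀K : i₀ ∈ cluster adj W Γ i₀ := mem_cluster_self adj hi₀
    have h2 : 2 ≤ (cluster adj W Γ i₀).card := two_le_card_of_ne_singleton hi₀K (hno i₀ (hKΓ hi₀K))
    rw [g1_of_two_le adj z h2, if_pos (isConn_of_mem_clusters hK)]
  · rw [clusters_filter_not_subset (adj := adj) W Γ, prod_image fun i _ j _ h => singleton_injective h]
    refine prod_congr rfl fun i _ => ?_
    rw [g1_singleton, hz.single]

/-- a `Γ` with an isolated interpolated cube contributes nothing (its singleton component has activity `0`).
[cite: BalabanImbrieJaffe1988, p.305 (Sect. 5.13)] -/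
theorem term_eq_zero_of_not_noIso {z : Finset ι → Finset ι → R} (hz : IsClusterFactorizing adj z)
    {W Γ : Finset ι} (hΓ : Γ ⊆ W) (h : ¬ NoIso adj W Γ) :
    (∏ K ∈ (clusters adj W Γ).filter (· ⊆ Γ), act z K) * ∏ i ∈ W \ Γ, z {i} ∅ = 0 := by
  simp only [NoIso, ne_eq, not_forall, not_not] at h
  obtain ⟨i, hi, hiso⟩ := h
  have hmem : ({i} : Finset ι) ∈ (clusters adj W Γ).filter (· ⊆ Γ) := by
    refine mem_filter.2 ⟨?_, singleton_subset_iff.2 hi⟩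
    rw [← hiso]
    exact cluster_mem_clusters adj (hΓ hi)
  rw [prod_eq_zero hmem (hz.act_singleton i), zero_mul]

/-- **DISPLAY (5.13.4), LEFT EQUALITY — THE POLYMER REPRESENTATION** (p. 306 [PDF 50], verbatim: *"We obtain the following expressions for
the dμ^{(k)}_{Λ^{(k)}_{10}}-integral in (5.12.8): Σ_{S_Y}Σ_{S_5} e^{−V^{(k)}_{const}(Λ^{(k)}_8)} Σ_{{X_α} filling Λ^{(k)}_{10}} Π_α g₁(X_α) =
e^{−V^{(k)}_{const}(Λ^{(k)}_8)} Σ_{{X_α}} Π_α g₂(X_α). (5.13.4)"* — i.e., at fixed Mayer data, `⟨Π_{i∈I} f(□_i)⟩_1 = Σ_{{X_α} filling} Π_α g₁(X_α)`)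
— PROVED for every cluster-factorizing family of corner expectations `z` (the p. 305 FTC expansion in corner form + the p. 306 factorization,
regrouped along the bijection `Γ ↦ its cluster configuration`): `z W W = Σ_{P admissible filling of W} Π_{X∈P} g₁(X)`, the fillings being the
set partitions of the cubes of `W` into polymers (as in `BIJ88Resummation5141`) that are ADMISSIBLE (`IsAdmissible`: no two polymers of ≥ 2
cubes abut — the cluster configurations; see `sum_setPartitions_eq` for the sum over all set partitions). [cite: BalabanImbrieJaffe1988, (5.13.4) p.306] -/
theorem polymerRep {z : Finset ι → Finset ι → R} (hz : IsClusterFactorizing adj z) (W : Finset ι) :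
    z W W = ∑ P ∈ (setPartitions W).filter (IsAdmissible adj), ∏ X ∈ P, g1 adj z X := by
  rw [hz.expansion' W, ← sum_filter_add_sum_filter_not W.powerset (NoIso adj W)]
  have h0 : ∑ Γ ∈ W.powerset with ¬ NoIso adj W Γ, (∏ K ∈ (clusters adj W Γ).filter (· ⊆ Γ), act z K) * ∏ i ∈ W \ Γ, z {i} ∅ = 0 :=
    sum_eq_zero fun Γ hΓ => term_eq_zero_of_not_noIso hz (mem_powerset.1 (mem_filter.1 hΓ).1) (mem_filter.1 hΓ).2
  rw [h0, add_zero]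
  conv_rhs => rw [← sum_filter_add_sum_filter_not _ (fun P => ∀ X ∈ P, IsConn adj X)]
  have h0' : ∑ P ∈ ((setPartitions W).filter (IsAdmissible adj)).filter (fun P => ¬ ∀ X ∈ P, IsConn adj X), ∏ X ∈ P, g1 adj z X = 0 := by
    refine sum_eq_zero fun P hP => ?_
    obtain ⟨hP, hnc⟩ := mem_filter.1 hP
    have hPp : IsSetPartition W P := mem_setPartitions.1 (mem_filter.1 hP).1
    simp only [not_forall] at hnc
    obtain ⟨X, hXP, hX⟩ := hnc
    refine prod_eq_zero hXP ?_
    have h2 : 2 ≤ X.card := by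
      by_contra hlt
      have hcard : X.card = 1 := by
        have := (hPp.nonempty_of_mem hXP).card_pos
        omega
      obtain ⟨i, rfl⟩ := card_eq_one.1 hcard
      exact hX (isConn_singleton adj i)
    rw [g1_of_two_le adj z h2, if_neg hX]
  rw [h0', add_zero]
  refine sum_nbij' (fun Γ => clusters adj W Γ) (fun P => bigPart P) ?_ ?_ ?_ ?_ ?_
  · intro Γ hΓ
    obtain ⟨hΓ, hno⟩ := mem_filter.1 hΓ
    simp only [mem_filter, mem_setPartitions]
    exact ⟨⟨isSetPartition_clusters adj W Γ, isAdmissible_clusters W Γ⟩, fun X hX => isConn_of_mem_clusters hX⟩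
  · intro P hP
    simp only [mem_filter, mem_setPartitions] at hP
    obtain ⟨⟨hPp, -⟩, hconn⟩ := hP
    refine mem_filter.2 ⟨mem_powerset.2 ?_, noIso_bigPart hPp hconn⟩
    intro i hi
    simp only [bigPart, mem_biUnion, mem_filter, id] at hi
    obtain ⟨X, ⟨hXP, -⟩, hiX⟩ := hi
    exact hPp.subset hXP hiX
  · intro Γ hΓ
    obtain ⟨hΓ, hno⟩ := mem_filter.1 hΓ
    exact bigPart_clusters (mem_powerset.1 hΓ) hno
  · intro P hP
    simp only [mem_filter, mem_setPartitions] at hP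
    obtain ⟨⟨hPp, hadm⟩, hconn⟩ := hP
    exact clusters_bigPart hPp hadm hconn
  · intro Γ hΓ
    obtain ⟨hΓ, hno⟩ := mem_filter.1 hΓ
    exact term_eq_prod_g1 hz hno

/-- **the sum over ALL set partitions** differs from `⟨Π f(□_i)⟩_1` exactly by the inadmissible fillings (pairs of abutting non-singleton
polymers): `Σ_{P filling W} Π_{X∈P} g₁(X) = z W W + Σ_{P not admissible} Π_{X∈P} g₁(X)`. [cite: BalabanImbrieJaffe1988, (5.13.4) p.306] -/
theorem sum_setPartitions_eq {z : Finset ι → Finset ι → R} (hz : IsClusterFactorizing adj z) (W : Finset ι) :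
    ∑ P ∈ setPartitions W, ∏ X ∈ P, g1 adj z X
      = z W W + ∑ P ∈ (setPartitions W).filter (fun P => ¬ IsAdmissible adj P), ∏ X ∈ P, g1 adj z X := by
  rw [polymerRep hz W, sum_filter_add_sum_filter_not]

end Fillings

/-! ## §6 A supply of cluster-factorizing data (products over clusters), and the over-count of the all-partitions reading -/

section ClusterProduct

variable (adj : ι → ι → Prop) [DecidableRel adj] {R : Type*} [CommRing R]

/-- **cluster-product data**: `z X Λ := Π_{K ∈ clusters(X,Λ)} c(K)` for an arbitrary weight `c` on regions — the shape the corner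
expectations take when each decoupled cluster contributes an independent factor (e.g. `c(K) = ⟨Π_{i∈K} f(□_i)⟩_{1,K}`); every such family is
cluster-factorizing (`isClusterFactorizing_zOf`). [cite: BalabanImbrieJaffe1988, p.306 (Sect. 5.13)] -/
def zOf (c : Finset ι → R) (X Λ : Finset ι) : R := ∏ K ∈ clusters adj X Λ, c K

/-- no cubes, no clusters. [cite: BalabanImbrieJaffe1988, p.306 (Sect. 5.13)] -/
theorem clusters_empty (Λ : Finset ι) : clusters adj ∅ Λ = ∅ := image_empty _

variable {adj}

/-- across a cut met by no active adjacent pair, the cluster of a cube of `X₁` in `X₁ ∪ X₂` is its cluster in `X₁`.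
[cite: BalabanImbrieJaffe1988, p.306 (Sect. 5.13)] -/
theorem cluster_union_left {X₁ X₂ Λ : Finset ι} (hcut : ∀ j ∈ X₁, ∀ j' ∈ X₂, j ∈ Λ → j' ∈ Λ → ¬ adj j j' ∧ ¬ adj j' j)
    {i : ι} (hi : i ∈ X₁) : cluster adj (X₁ ∪ X₂) Λ i = cluster adj X₁ Λ i := by
  refine Subset.antisymm ?_ ?_
  · refine cluster_subset_of_closed adj ((cluster_subset adj X₁ Λ i).trans subset_union_left) (mem_cluster_self adj hi) ?_
    intro j hj j' hj' hjΛ hj'Λ hne hadj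
    have hjX₁ : j ∈ X₁ := cluster_subset adj X₁ Λ i hj
    rcases mem_union.1 hj' with hj'X₁ | hj'X₂
    · exact mem_cluster_of_adj adj hj hjΛ hj'Λ hj'X₁ hne hadj
    · exfalso
      obtain ⟨h1, h2⟩ := hcut j hjX₁ j' hj'X₂ hjΛ hj'Λ
      exact hadj.elim h1 h2
  · have h : cluster adj X₁ Λ i ⊆ cluster adj (X₁ ∪ X₂) Λ i ∩ X₁ := by
      refine cluster_subset_of_closed adj inter_subset_right
        (mem_inter.2 ⟨mem_cluster_self adj (mem_union_left _ hi), hi⟩) ?_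
      intro j hj j' hj'X₁ hjΛ hj'Λ hne hadj
      exact mem_inter.2 ⟨mem_cluster_of_adj adj (mem_inter.1 hj).1 hjΛ hj'Λ (mem_union_left _ hj'X₁) hne hadj, hj'X₁⟩
    exact h.trans inter_subset_left

/-- across a cut met by no active adjacent pair, the clusters of `X₁ ∪ X₂` are those of `X₁` and those of `X₂`.
[cite: BalabanImbrieJaffe1988, p.306 (Sect. 5.13)] -/
theorem clusters_union {X₁ X₂ Λ : Finset ι} (hcut : ∀ j ∈ X₁, ∀ j' ∈ X₂, j ∈ Λ → j' ∈ Λ → ¬ adj j j' ∧ ¬ adj j' j) :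
    clusters adj (X₁ ∪ X₂) Λ = clusters adj X₁ Λ ∪ clusters adj X₂ Λ := by
  have hcut' : ∀ j ∈ X₂, ∀ j' ∈ X₁, j ∈ Λ → j' ∈ Λ → ¬ adj j j' ∧ ¬ adj j' j :=
    fun j hj j' hj' hjΛ hj'Λ => (hcut j' hj' j hj hj'Λ hjΛ).symm
  simp only [clusters, BIJ88ElementaryRegions304.regions, image_union]
  congr 1
  · exact image_congr fun i hi => cluster_union_left hcut (mem_coe.1 hi)
  · refine image_congr fun i hi => ?_
    show cluster adj (X₁ ∪ X₂) Λ i = cluster adj X₂ Λ i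
    rw [union_comm]
    exact cluster_union_left hcut' (mem_coe.1 hi)

/-- clusters of disjoint regions are different. [cite: BalabanImbrieJaffe1988, p.306 (Sect. 5.13)] -/
theorem disjoint_clusters {X₁ X₂ : Finset ι} (hd : Disjoint X₁ X₂) (Λ₁ Λ₂ : Finset ι) :
    Disjoint (clusters adj X₁ Λ₁) (clusters adj X₂ Λ₂) := by
  refine disjoint_left.2 fun K hK₁ hK₂ => ?_
  obtain ⟨i, hi⟩ := (isSetPartition_clusters adj X₁ Λ₁).nonempty_of_mem hK₁
  exact disjoint_left.1 hd ((isSetPartition_clusters adj X₁ Λ₁).subset hK₁ hi) ((isSetPartition_clusters adj X₂ Λ₂).subset hK₂ hi)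

variable (adj)

/-- **every cluster-product family is cluster-factorizing** (so the polymer representation `polymerRep` and the over-count formula
`sum_setPartitions_eq` apply to it). [cite: BalabanImbrieJaffe1988, p.306 (Sect. 5.13)] -/
theorem isClusterFactorizing_zOf (c : Finset ι → R) : IsClusterFactorizing adj (zOf adj c) where
  empty Λ := by rw [zOf, clusters_empty, prod_empty]
  local_inter X Λ := by rw [zOf, zOf, clusters_inter]
  split X₁ X₂ Λ hd hcut := by rw [zOf, clusters_union hcut, prod_union (disjoint_clusters hd Λ Λ), zOf, zOf]
  single i := by rw [zOf, zOf, clusters_singleton_region, clusters_singleton_region]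

/-- with all cubes of `X` active in a connected `X`, the cluster product is the weight of `X`. [cite: BalabanImbrieJaffe1988, p.306 (Sect. 5.13)] -/
theorem zOf_self_of_isConn (c : Finset ι → R) {X : Finset ι} (hX : X.Nonempty) (hconn : IsConn adj X) : zOf adj c X X = c X := by
  rw [zOf, (clusters_eq_singleton_iff adj hX).2 hconn, prod_singleton]

/-- if the weight vanishes on single cubes, only fully active corners survive: `z X Λ = 0` unless `X ⊆ Λ`.
[cite: BalabanImbrieJaffe1988, p.306 (Sect. 5.13)] -/
theorem zOf_eq_zero_of_not_subset {c : Finset ι → R} (hc : ∀ i, c {i} = 0) {X Λ : Finset ι} (h : ¬ X ⊆ Λ) : zOf adj c X Λ = 0 := by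
  obtain ⟨i, hiX, hiΛ⟩ := not_subset.1 h
  refine prod_eq_zero (cluster_mem_clusters adj (Λ := Λ) hiX) ?_
  rw [cluster_of_not_mem adj hiX hiΛ, hc]

/-- … so that the derivative activity of `X` is the fully active corner value. [cite: BalabanImbrieJaffe1988, p.306 (Sect. 5.13)] -/
theorem act_zOf {c : Finset ι → R} (hc : ∀ i, c {i} = 0) (X : Finset ι) : act (zOf adj c) X = zOf adj c X X := by
  rw [act, cornerSum, sum_eq_single_of_mem X (mem_powerset.2 Subset.rfl)]
  · rw [sdiff_self, Finset.bot_eq_empty, card_empty, pow_zero, one_mul]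
  · intro Λ hΛ hne
    rw [zOf_eq_zero_of_not_subset adj hc fun h => hne (Subset.antisymm (mem_powerset.1 hΛ) h), mul_zero]

/-- … and the printed activity of a region of ≥ 2 cubes is its weight if connected, `0` otherwise. [cite: BalabanImbrieJaffe1988, p.306 (Sect. 5.13)] -/
theorem g1_zOf_of_two_le {c : Finset ι → R} (hc : ∀ i, c {i} = 0) {X : Finset ι} (h2 : 2 ≤ X.card) :
    g1 adj (zOf adj c) X = if IsConn adj X then c X else 0 := by
  rw [g1_of_two_le adj _ h2]
  split_ifs with h
  · rw [act_zOf adj hc, zOf_self_of_isConn adj c (card_pos.1 (by omega)) h]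
  · rfl

/-- the printed activity of a single cube is its weight. [cite: BalabanImbrieJaffe1988, p.306 (Sect. 5.13)] -/
theorem g1_zOf_singleton (c : Finset ι → R) (i : ι) : g1 adj (zOf adj c) {i} = c {i} := by
  rw [g1_singleton, zOf, clusters_singleton_region, prod_singleton]

/-- the printed activity of the empty region vanishes. [cite: BalabanImbrieJaffe1988, p.306 (Sect. 5.13)] -/
theorem g1_empty (z : Finset ι → Finset ι → R) : g1 adj z ∅ = 0 := by
  rw [g1]
  refine sum_eq_zero fun Γ hΓ => ?_
  obtain ⟨-, h⟩ := mem_filter.1 hΓ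
  rw [clusters_empty] at h
  have hmem : (∅ : Finset ι) ∈ (∅ : Finset (Finset ι)) := by
    rw [h]
    exact mem_singleton_self _
  exact absurd hmem (notMem_empty _)

end ClusterProduct

/-! ## §7 Kernel witness: summed over ALL set partitions, the right side of (5.13.4) over-counts (four cubes in a row) -/

section Witness

/-- witness geometry for the reading note on (5.13.4): integer-labelled cubes in a row, `a` abuts `b` iff `|a − b| = 1`.
[cite: BalabanImbrieJaffe1988, (5.13.4) p.306] -/
def nn (a b : ℤ) : Prop := b = a + 1 ∨ a = b + 1

/-- decidability of the witness adjacency. [cite: BalabanImbrieJaffe1988, (5.13.4) p.306] -/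
instance instDecidableRelNn : DecidableRel nn := fun a b => inferInstanceAs (Decidable (b = a + 1 ∨ a = b + 1))

/-- witness weight: `0` on single cubes, `1` on every larger region. [cite: BalabanImbrieJaffe1988, (5.13.4) p.306] -/
def cPath (X : Finset ℤ) : ℤ := if X.card = 1 then 0 else 1

/-- the witness region: four cubes `0, 1, 2, 3` in a row. [cite: BalabanImbrieJaffe1988, (5.13.4) p.306] -/
def W4 : Finset ℤ := {0, 1, 2, 3}

/-- the witness weight vanishes on single cubes. [cite: BalabanImbrieJaffe1988, (5.13.4) p.306] -/
theorem cPath_singleton (i : ℤ) : cPath {i} = 0 := by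
  simp [cPath]

/-- the row of four cubes is connected. [cite: BalabanImbrieJaffe1988, (5.13.4) p.306] -/
theorem isConn_W4 : IsConn nn W4 := by
  decide

/-- the pair `{0,1}` is connected. [cite: BalabanImbrieJaffe1988, (5.13.4) p.306] -/
theorem isConn_pair01 : IsConn nn ({0, 1} : Finset ℤ) := by
  decide

/-- the pair `{2,3}` is connected. [cite: BalabanImbrieJaffe1988, (5.13.4) p.306] -/
theorem isConn_pair23 : IsConn nn ({2, 3} : Finset ℤ) := by
  decide

/-- all printed activities of the witness are `≥ 0` (they are `0` or `1`). [cite: BalabanImbrieJaffe1988, (5.13.4) p.306] -/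
theorem g1_cPath_nonneg (X : Finset ℤ) : 0 ≤ g1 nn (zOf nn cPath) X := by
  rcases Nat.lt_or_ge X.card 2 with h | h
  · rcases Nat.lt_or_ge X.card 1 with h0 | h1
    · have hX : X = ∅ := card_eq_zero.1 (by omega : X.card = 0)
      rw [hX, g1_empty]
    · obtain ⟨i, rfl⟩ := card_eq_one.1 (by omega : X.card = 1)
      rw [g1_zOf_singleton, cPath_singleton]
  · rw [g1_zOf_of_two_le nn cPath_singleton h]
    split_ifs
    · simp only [cPath]
      split_ifs <;> omega
    · exact le_rfl

/-- `⟨Π_{i∈W} f(□_i)⟩_1` of the witness: `z W W = 1`. [cite: BalabanImbrieJaffe1988, (5.13.4) p.306] -/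
theorem zOf_cPath_W4 : zOf nn cPath W4 W4 = 1 := by
  rw [zOf_self_of_isConn nn cPath (by decide) isConn_W4]
  decide

/-- the filling `{{0,1},{2,3}}` by two ABUTTING pairs is a set partition of the row but NOT admissible (it is the cluster configuration of
no `Γ`), and it contributes `g₁({0,1})·g₁({2,3}) = 1`. [cite: BalabanImbrieJaffe1988, (5.13.4) p.306] -/
theorem witness_filling :
    ({{0, 1}, {2, 3}} : Finset (Finset ℤ)) ∈ setPartitions W4 ∧ ¬ IsAdmissible nn ({{0, 1}, {2, 3}} : Finset (Finset ℤ))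
      ∧ ∏ X ∈ ({{0, 1}, {2, 3}} : Finset (Finset ℤ)), g1 nn (zOf nn cPath) X = 1 := by
  refine ⟨mem_setPartitions.2 (by decide), by decide, ?_⟩
  rw [prod_pair (by decide), g1_zOf_of_two_le nn cPath_singleton (by decide), if_pos isConn_pair01,
    g1_zOf_of_two_le nn cPath_singleton (by decide), if_pos isConn_pair23]
  decide

/-- **the all-partitions sum is at least `2`** (`1` from the admissible filling `{W}`, `1` from the inadmissible `{{0,1},{2,3}}`, all
other terms `≥ 0`). [cite: BalabanImbrieJaffe1988, (5.13.4) p.306] -/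
theorem two_le_sum_setPartitions_W4 : (2 : ℤ) ≤ ∑ P ∈ setPartitions W4, ∏ X ∈ P, g1 nn (zOf nn cPath) X := by
  have hP₀ : ({{0, 1}, {2, 3}} : Finset (Finset ℤ)) ∈ setPartitions W4 := witness_filling.1
  have hP₁ : ({W4} : Finset (Finset ℤ)) ∈ setPartitions W4 :=
    mem_setPartitions.2 (Literature.Probability.LatticeModels.isSetPartition_singleton (by decide))
  have hne : ({{0, 1}, {2, 3}} : Finset (Finset ℤ)) ≠ {W4} := by decide
  have hsub : ({{{0, 1}, {2, 3}}, {W4}} : Finset (Finset (Finset ℤ))) ⊆ setPartitions W4 := by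
    intro P hP
    rcases mem_insert.1 hP with rfl | hP
    · exact hP₀
    · rw [mem_singleton.1 hP]
      exact hP₁
  have h2 : ∑ P ∈ ({{{0, 1}, {2, 3}}, {W4}} : Finset (Finset (Finset ℤ))), ∏ X ∈ P, g1 nn (zOf nn cPath) X = 2 := by
    rw [sum_pair hne, witness_filling.2.2, prod_singleton, g1_zOf_of_two_le nn cPath_singleton (by decide), if_pos isConn_W4]
    decide
  rw [← h2]
  exact sum_le_sum_of_subset_of_nonneg hsub fun P _ _ => prod_nonneg fun X _ => g1_cPath_nonneg X

/-- **READING NOTE ON (5.13.4), KERNEL-CHECKED**: for the cluster-factorizing family `zOf nn cPath` on four cubes in a row,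
`Σ_{P ∈ ALL set partitions of W} Π_{X∈P} g₁(X) ≠ z W W` (`≥ 2` versus `1`), whereas the admissible sum IS `z W W` (`polymerRep`). With the
paper's cube-wise interpolation *"{X_α} filling Λ^{(k)}_{10}"* in (5.13.4) must therefore be read as the cluster configurations (admissible
fillings), not as all set partitions into polymers. [cite: BalabanImbrieJaffe1988, (5.13.4) p.306] -/
theorem sum_setPartitions_ne_W4 :
    (∑ P ∈ setPartitions W4, ∏ X ∈ P, g1 nn (zOf nn cPath) X) ≠ zOf nn cPath W4 W4
      ∧ zOf nn cPath W4 W4 = ∑ P ∈ (setPartitions W4).filter (IsAdmissible nn), ∏ X ∈ P, g1 nn (zOf nn cPath) X := by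
  refine ⟨?_, polymerRep (isClusterFactorizing_zOf nn cPath) W4⟩
  rw [zOf_cPath_W4]
  have h := two_le_sum_setPartitions_W4
  omega

end Witness

end Literature.MathematicalPhysics.QuantumFieldTheory.BalabanImbrieJaffe1984to88.BIJ88PolymerRep5134
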